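import Literature.NumberTheory.LFunctions.CharZeroSum
import Mathlib.Analysis.Calculus.ContDiff.Defs
import HarnessLib

/-!
# One-level density of Dirichlet `L`-functions: the prime-modulus family with Fourier support
# `[-2, 2]` (Hughes–Rudnick 2003, Theorem 3.1) and the conductor-averaged family with support
# beyond `2` (Drappeau–Pratt–Radziwiłł 2023, Theorem 1)

Topic `Literature/NumberTheory/LFunctions` (namespace `Literature.NumberTheory.LFunctions`,
sub-namespace `OneLevelDensity`). STATEMENT LAYER (D-0014: sorry-free named `Prop` facts, nothing
asserted): the two printed evaluations of the LINEAR STATISTIC ("one-level density")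
`W_f(χ) = Σ_{γ_χ} f((log q / 2π) γ_χ)` of the low-lying zeros `1/2 + iγ_χ` of Dirichlet
`L`-functions that fix, in print, how far the Fourier support of the test function can be taken:
`supp f̂ ⊆ [-2, 2]` for ONE PRIME modulus (Hughes–Rudnick), and `supp φ̂ ⊂ [-2-50/1093, 2+50/1093]`
— the only unconditional crossing of the support-`2` edge for a family of Dirichlet characters —
when the conductor is also averaged (Drappeau–Pratt–Radziwiłł). Typed for the repair rung F-S1R
of the cell `siegel-zhang` (HOME/repair/ESTAR.md rows E1/E2, lever E*-len), where "support `2`"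
is the dictionary edge "Dirichlet polynomials of total length = (family size)" against which a
hypothetical estimate beyond the edge is priced; both are theorems in print, typed as named facts,
not conjectures and not claims about the manuscript adjudicated by that cell. Companion (same edge
for twisted second moments to one prime modulus):
`Literature.NumberTheory.LFunctions.buiPrattRoblesZaharescu2020_theorem11`.

## What the sources print (held arXiv texts, read 2026-08-26)

**[HR03]** C. P. Hughes, Z. Rudnick, *Linear statistics of low-lying zeros of `L`-functions*,
Quart. J. Math. **54** (2003) 309–333 = arXiv:math/0208230.
§1 (p. 2): "Each function `L(s,χ)` has an infinite set of non-trivial zeros `1/2 + iγ_{χ,j}` …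
Note that we don't assume the Generalised Riemann Hypothesis (GRH) since we allow the `γ_{χ,j}`
to be complex. … `x_{χ,j} := (log q / 2π) γ_{χ,j}` … `W_f(χ) := Σ_{j=-∞}^{∞} f(x_{χ,j})` …
`⟨W_f⟩_q := (1/(q-2)) Σ_{χ ≠ χ₀} W_f(χ)`" (`q` prime; the `q − 2` non-trivial characters).
"Throughout all this paper, the Fourier transform is `f̂(u) = ∫ f(x) e^{-2πixu} dx`."
§2.2, Definition 2.1: "`f(x)` is an admissible test function for `W_f(χ)` if it is a real, even
function, whose Fourier transform `f̂(u)` is compactly supported, and such that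
`f(r) ≪ (1+|r|)^{-1-δ}`"; `W_f(χ) := Σ_j f((log q/2π) γ_{χ,j})`, "the sum over all nontrivial
zeros of `L(s,χ)`". §3: "**Theorem 3.1.** Let `f` be an admissible function, and assume
`supp(f̂) ⊆ [-2, 2]`. Then as `q → ∞`, `⟨W_f⟩_q = ∫_{-∞}^{∞} f(x) dx + O(1/log q)`."
(`q → ∞` through primes: "the average over all `q − 2` nontrivial characters modulo prime `q`".)

**[DPR23]** S. Drappeau, K. Pratt, M. Radziwiłł, *One-level density estimates for Dirichlet
`L`-functions with extended support*, Algebra Number Theory **17** (2023) 805–830 =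
arXiv:2002.11968. §1: "**Theorem 1.** Let `Φ` be a smooth function compactly supported in
`[3/4, 9/4]`, and `φ` be a smooth function such that `supp φ̂ ⊂ [-2 - 50/1093, 2 + 50/1093]`.
Then, as `Q → ∞`,
`Σ_q Φ(q/Q) Σ_{χ (mod q) primitive} Σ_{γ_χ} φ((log Q / 2π) γ_χ)
   = φ̂(0) Σ_q Φ(q/Q) Σ_{χ (mod q) primitive} 1 + o(Q²)`.
Here `1/2 + iγ_χ` correspond to zeros of `L(s,χ)` and since we do not assume the Generalized
Riemann Hypothesis we allow the `γ_χ` to be complex. Note that `φ`, initially defined on `ℝ`, is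
analytically continued to `ℂ` by compactness of `supp φ̂`." (The explicit formula of §2.2 is
applied with `φ((ρ − 1/2) log Q / (2πi))` summed over `ρ ∈ ℂ`, `Re ρ ∈ (0,1)`, `L(ρ,χ) = 0`.)
"This gives the first example of a family of `L`-functions in which the support is
unconditionally extended past the “trivial range”."

## Lean rendering / design choices

* ZEROS. The tree's `ExplicitPsiChar.charNontrivialZeros χ = {ρ : L(ρ,χ) = 0, 0 < Re ρ < 1}`
  (each listed once) with multiplicity `DirichletDisc.zeroOrder χ ρ` (`CharZeroSum.lean`); nothing
  about zeros is re-declared. Writing `ρ = 1/2 + iγ` (γ complex, as in both sources) the scaled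
  ordinate is `x(ρ; L) = (L/2π)·γ = (L/2π)·(ρ − 1/2)/i` (`scaledOrdinate`; `L = log q` in [HR03],
  `L = log Q` in [DPR23]). The linear statistic is the `tsum` over the zero subtype weighted by the
  multiplicity (`linearStatistic`); for the test functions below it converges absolutely
  (`CharZeroSum.summable_zeroOrder_div_one_add_sq` and the super-polynomial decay of `f` on the
  strip `|Im| ≤ L/4π`), so the `tsum` IS the printed `Σ_{j=-∞}^{∞}`.
* TEST FUNCTIONS are parametrised by their FOURIER PROFILE `g = f̂` (convention of both sources:
  `f̂(u) = ∫ f(x) e^{−2πixu} dx`): `testFn g z := ∫ g(u) e^{2πizu} du`, an entire function of `z`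
  when `g` has compact support, equal on `ℝ` to the inverse Fourier transform of `g`, so that
  `f̂ = g` (Fourier inversion for `g ∈ C_c^∞`) and `∫ f = g(0)`. This makes "`supp f̂ ⊆ [−σ, σ]`"
  the elementary condition `tsupport g ⊆ [−σ, σ]` and gives the analytic continuation both sources
  use to evaluate `f` at complex `γ`. SPECIAL CASE (flagged `TODO(general form)` on the fact):
  [HR03] admit any real even `f` with compactly supported `f̂` and `f(r) ≪ (1+|r|)^{-1-δ}`; here
  `f̂ = g ∈ C_c^∞(ℝ)` real and even (then `f` is real, even, Schwartz) — the sub-class every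
  application uses; [DPR23]'s "smooth `φ` with compactly supported `φ̂`" is read as `φ̂ ∈ C_c^∞`,
  i.e. `φ` Schwartz, which is how the explicit formula of their §2.2 is applied.
* [HR03]: `q` prime, `[NeZero q]`; "`χ ≠ χ₀`" = `χ ≠ 1`; the normalisation `1/(q−2)` is kept
  verbatim (`primeModulusAverage`); main term `∫_ℝ f` verbatim; "`O(1/log q)` as `q → ∞`" =
  `∃ C q₀, ∀ prime q ≥ q₀, ‖⟨W_f⟩_q − ∫ f‖ ≤ C/log q` (constant depending on `f`).
* [DPR23]: the `q`-sum is finite (`Φ(q/Q) = 0` unless `3Q/4 ≤ q ≤ 9Q/4`); it is written as a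
  `Finset` sum over `q = n+1 ≤ 3⌈Q⌉` so that `[NeZero q]` is automatic (`primitiveFamilySum`,
  `primitiveFamilyCount`); "primitive" = Mathlib `DirichletCharacter.IsPrimitive`; `φ̂(0) = g 0`;
  "`= M(Q) + o(Q²)` as `Q → ∞`" = `(S(Q) − M(Q))/Q² → 0` along `atTop` on `ℝ`.
* No instances, no notation, no new zero set; imports `CharZeroSum` only (plus Mathlib).

References: [cite: HughesRudnick2003, §§1–3, Theorem 3.1]; [cite: DrappeauPrattRadziwill2023,
§1 Theorem 1, §2.2]; zero vocabulary [cite: MontgomeryVaughan2007, Corollary 10.8] via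
`CharZeroSum`.
-/

noncomputable section

open Complex Filter Topology Set Finset MeasureTheory
open scoped ContDiff

namespace Literature.NumberTheory.LFunctions

namespace OneLevelDensity

/-! ### Test functions from their Fourier profile -/

/-- The test function with Fourier profile `g`: `f(z) = ∫_ℝ g(u) e^{2πizu} du` for `z ∈ ℂ`. When
`g` has compact support this is an entire function of `z`; on `ℝ` it is the inverse Fourier
transform of `g` in the convention `f̂(u) = ∫ f(x)e^{−2πixu}dx` of both sources, so `f̂ = g` for
`g ∈ C_c^∞(ℝ)`. This is the analytic continuation "by compactness of `supp φ̂`" used to evaluate the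
test function at complex ordinates. [cite: HughesRudnick2003, §1 (Fourier convention), Definition 2.1]
[cite: DrappeauPrattRadziwill2023, §1, remark after Theorem 1] -/
def testFn (g : ℝ → ℂ) (z : ℂ) : ℂ :=
  ∫ u : ℝ, g u * Complex.exp (2 * (Real.pi : ℂ) * Complex.I * z * (u : ℂ))

/-- At `z = 0` the test function is the total mass of its profile: `f(0) = ∫ g` (the sources'
inverse-transform convention `f(x) = ∫ f̂(u) e^{2πixu} du` at `x = 0`).
[cite: HughesRudnick2003, §1 (Fourier convention)] -/
theorem testFn_zero (g : ℝ → ℂ) : testFn g 0 = ∫ u : ℝ, g u := by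
  simp [testFn]

/-- The scaled ordinate of a zero `ρ = 1/2 + iγ` at logarithmic scale `L`:
`x(ρ; L) = (L/2π)·γ = (L/2π)·(ρ − 1/2)/i` (`γ` complex unless GRH; `L = log q` in [HR03],
`L = log Q` in [DPR23]). [cite: HughesRudnick2003, §1 (definition of x_{χ,j})]
[cite: DrappeauPrattRadziwill2023, §2.2 (φ((ρ−1/2) log Q/(2πi)))] -/
def scaledOrdinate (L : ℝ) (ρ : ℂ) : ℂ :=
  ((L / (2 * Real.pi) : ℝ) : ℂ) * ((ρ - 1 / 2) / Complex.I)

/-- On the critical line the scaled ordinate is the real number `(L/2π)·t` — the sources'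
`x_{χ,j} = (log q/2π) γ_{χ,j}` for a zero `1/2 + iγ` with `γ = t` real.
[cite: HughesRudnick2003, §1 (definition of x_{χ,j})] -/
theorem scaledOrdinate_half_add (L t : ℝ) :
    scaledOrdinate L (1 / 2 + (t : ℂ) * Complex.I) = (((L / (2 * Real.pi)) * t : ℝ) : ℂ) := by
  have hI : Complex.I ≠ 0 := Complex.I_ne_zero
  simp only [scaledOrdinate, Complex.ofReal_mul]
  field_simp
  ring

variable {q : ℕ} [NeZero q]

/-- The linear statistic (one-level density sum) of `χ` mod `q` with Fourier profile `g` at scale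
`L`: `W(χ; g, L) = Σ_ρ m(ρ) · f(x(ρ; L))`, the sum over the non-trivial zeros `ρ` of `L(s,χ)`
counted with multiplicity `m(ρ) = DirichletDisc.zeroOrder χ ρ`, `f = testFn g`. For the profiles
of the two facts below the series converges absolutely, so the `tsum` is the printed
`Σ_{j=-∞}^{∞} f(x_{χ,j})`. [cite: HughesRudnick2003, §2.2 (W_f(χ))]
[cite: DrappeauPrattRadziwill2023, §1 Theorem 1 (inner sum over γ_χ)] -/
def linearStatistic (χ : DirichletCharacter ℂ q) (g : ℝ → ℂ) (L : ℝ) : ℂ :=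
  ∑' ρ : ExplicitPsiChar.charNontrivialZeros χ,
    (DirichletDisc.zeroOrder χ (ρ : ℂ) : ℂ) * testFn g (scaledOrdinate L (ρ : ℂ))

/-! ### Hughes–Rudnick 2003, Theorem 3.1 (one prime modulus, support `[-2, 2]`) -/

open scoped Classical in
/-- The Hughes–Rudnick expectation over the `q − 2` non-trivial characters modulo a prime `q`:
`⟨W_f⟩_q = (1/(q−2)) Σ_{χ ≠ χ₀ (mod q)} W_f(χ)`, scale `L = log q`.
[cite: HughesRudnick2003, §1 and §3 (definition of ⟨W_f⟩_q)] -/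
def primeModulusAverage (q : ℕ) [NeZero q] (g : ℝ → ℂ) : ℂ :=
  (∑ χ : DirichletCharacter ℂ q with χ ≠ 1, linearStatistic χ g (Real.log q)) / ((q : ℂ) - 2)

/-- **Hughes–Rudnick 2003, Theorem 3.1** (one-level density of `L(s,χ)`, `χ` mod a prime `q`,
Fourier support `[-2, 2]`, unconditionally): for every admissible test function `f` with
`supp f̂ ⊆ [−2, 2]`, `⟨W_f⟩_q = ∫_{−∞}^{∞} f(x) dx + O(1/log q)` as `q → ∞` through the primes.
Typed for the sub-class `f̂ = g ∈ C_c^∞(ℝ)`, real-valued and even (then `f = testFn g` is real,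
even and Schwartz, hence admissible in the sense of [HR03, Def. 2.1]).
-- TODO(general form): [HR03] allow any real even `f` with compactly supported `f̂` and
-- `f(r) ≪ (1+|r|)^{−1−δ}` for some `δ > 0`.
[cite: HughesRudnick2003, Theorem 3.1] -/
def hughesRudnick2003_theorem31 : Prop :=
  ∀ g : ℝ → ℝ, ContDiff ℝ ∞ g → (∀ u, g (-u) = g u) → tsupport g ⊆ Set.Icc (-2 : ℝ) 2 →
    ∃ C : ℝ, ∃ q₀ : ℕ, ∀ (q : ℕ) [NeZero q], q.Prime → q₀ ≤ q →
      ‖primeModulusAverage q (fun u => (g u : ℂ)) -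
          ∫ x : ℝ, testFn (fun u => (g u : ℂ)) (x : ℂ)‖ ≤ C / Real.log q

/-! ### Drappeau–Pratt–Radziwiłł 2023, Theorem 1 (conductor-averaged family, support beyond `2`) -/

/-- The half-width of the extended Fourier support of Drappeau–Pratt–Radziwiłł: `2 + 50/1093`.
[cite: DrappeauPrattRadziwill2023, Theorem 1] -/
def dprSupport : ℝ := 2 + 50 / 1093

/-- The extended support exceeds the "trivial" edge `2` by `50/1093 ≈ 0.0457` ("the first example of
a family … in which we can unconditionally enlarge the support past the trivial range").
[cite: DrappeauPrattRadziwill2023, §1 Theorem 1] -/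
theorem two_lt_dprSupport : (2 : ℝ) < dprSupport := by
  norm_num [dprSupport]

open scoped Classical in
/-- The weighted family sum of Drappeau–Pratt–Radziwiłł at scale `Q`:
`S(Q) = Σ_q Φ(q/Q) Σ_{χ (mod q) primitive} Σ_{γ_χ} φ((log Q/2π) γ_χ)`, with `φ = testFn g`. The
`q`-sum is finite (`Φ` is supported in `[3/4, 9/4]`, so only `3Q/4 ≤ q ≤ 9Q/4` contribute); it is
written over `q = n + 1 ≤ 3⌈Q⌉`. [cite: DrappeauPrattRadziwill2023, Theorem 1 (left-hand side)] -/
def primitiveFamilySum (Φ : ℝ → ℝ) (g : ℝ → ℂ) (Q : ℝ) : ℂ :=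
  ∑ n ∈ Finset.range (3 * ⌈Q⌉₊),
    ((Φ (((n + 1 : ℕ) : ℝ) / Q) : ℝ) : ℂ) *
      ∑ χ : DirichletCharacter ℂ (n + 1) with χ.IsPrimitive, linearStatistic χ g (Real.log Q)

open scoped Classical in
/-- The weighted count of the family: `N(Q) = Σ_q Φ(q/Q) · #{χ (mod q) primitive}` (same finite
range `q = n + 1 ≤ 3⌈Q⌉`). [cite: DrappeauPrattRadziwill2023, Theorem 1 (right-hand side)] -/
def primitiveFamilyCount (Φ : ℝ → ℝ) (Q : ℝ) : ℝ :=
  ∑ n ∈ Finset.range (3 * ⌈Q⌉₊),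
    Φ (((n + 1 : ℕ) : ℝ) / Q) *
      ((Finset.univ.filter fun χ : DirichletCharacter ℂ (n + 1) => χ.IsPrimitive).card : ℝ)

/-- **Drappeau–Pratt–Radziwiłł 2023, Theorem 1** (one-level density of primitive Dirichlet
`L`-functions with conductor weight `Φ(q/Q)`, Fourier support BEYOND `(−2, 2)`, unconditionally):
for `Φ` smooth and supported in `[3/4, 9/4]` and `φ` with `supp φ̂ ⊂ [−2 − 50/1093, 2 + 50/1093]`,
`Σ_q Φ(q/Q) Σ_{χ primitive (q)} Σ_{γ_χ} φ((log Q/2π)γ_χ) = φ̂(0)·Σ_q Φ(q/Q) Σ_{χ primitive (q)} 1 + o(Q²)`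
as `Q → ∞`. Typed with `φ̂ = g ∈ C_c^∞(ℝ)` (so `φ = testFn g`, `φ̂(0) = g 0`) and "`o(Q²)`" as
`(S(Q) − g(0)·N(Q))/Q² → 0`.
-- TODO(general form): the source's remark that support `[−2−50/1093+ε, 2+50/1093−ε]` gives a
-- power saving `O(Q^{2−δ(ε)})` (with slightly altered main terms) is not typed.
[cite: DrappeauPrattRadziwill2023, Theorem 1] -/
def drappeauPrattRadziwill2023_theorem1 : Prop :=
  ∀ Φ : ℝ → ℝ, ContDiff ℝ ∞ Φ → tsupport Φ ⊆ Set.Icc (3 / 4 : ℝ) (9 / 4) →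
    ∀ g : ℝ → ℂ, ContDiff ℝ ∞ g → tsupport g ⊆ Set.Icc (-dprSupport) dprSupport →
      Tendsto (fun Q : ℝ =>
          (primitiveFamilySum Φ g Q - g 0 * (primitiveFamilyCount Φ Q : ℂ)) / ((Q : ℂ) ^ 2))
        atTop (𝓝 0)

/-- Bookkeeping: a profile admissible for Hughes–Rudnick (`supp g ⊆ [−2, 2]`) is a fortiori
admissible for Drappeau–Pratt–Radziwiłł (`supp g ⊆ [−2 − 50/1093, 2 + 50/1093]`) — the printed
crossing of the support-`2` edge. [cite: DrappeauPrattRadziwill2023, §1 Theorem 1]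
[cite: HughesRudnick2003, Theorem 3.1] -/
theorem tsupport_subset_dpr_of_subset_two {g : ℝ → ℂ} (h : tsupport g ⊆ Set.Icc (-2 : ℝ) 2) :
    tsupport g ⊆ Set.Icc (-dprSupport) dprSupport := by
  refine h.trans (Set.Icc_subset_Icc ?_ ?_) <;> norm_num [dprSupport]

end OneLevelDensity

end Literature.NumberTheory.LFunctions

end
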